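import Summits.NavierStokesRegularity.NavierStokesRegularity.Theorems.ScenarioCensusRowF1RingTopCovariance
import HarnessLib

/-!
# LINE 44 «ring-top» port, part 4/6: §4b structure of the VORTEX-LINE tops in `𝒦_M` and the two kills; limits with a MOVING APEX for a first-order defect; the LEVELS

Re-homed for the scenario census (typer seat ns-census-typer-1 g10; the cells F1rx / F1krx and the floors are members of row F1 «DECIDED IN KERNEL IN FILES» (LINE 44: ref ns-census-ref g16
PRE-CHECK ✓ §21.18, critic PASS, lead booking OF RECORD at census v1.133); this port makes them TREE-decided): VERBATIM PORT of ns-idea-3 LINE 44 «ring-top»,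
`pub/ideators/ns-idea-3/lines/ring-top/line-ring-top.lean` sha16 74d818dbb34ba3da (1774 l., lean check rc 0, 0 sorry), split for the 400-line rule into `ScenarioCensusRowF1RingTop`
(§1) → `…RingTopZoom` (§2–§3) → `…RingTopCovariance` (§4a) → `…RingTopKill` (§4b) → `…RingTopFloors` (§5) → `…RingTopRows` (§6–§7 + census KEYS).  Lean text VERBATIM in namespace
`…Theorems.ScenarioCensus.RingTop` (the line's `…Cruxes.ScenarioCensusRowF1.RingTopLine` re-homed); port edits: the frame restated VERBATIM by the line from LINES 34–42 (`topSet`,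
`HasTypeIConstant`, `snapLevel`, `exists_fast_at`, `sqrt_mul_sq_mul`, `continuous_slice'`, `rotLin`, `rotCLM`, `coe_rotCLM`, `analyticAt_transport`, `rotZ_smul_eZ'`, `zoom_units`,
`eventually_forall_not_of_not_frequently`, `le_of_units`) is taken BY NAME from the landed ports (the line's own STRENGTHENED compactness / socket / zoom package / `tendsto_eval` with gradients are new statements and kept; `row_of_floor` = `ScalingTop.row_of_floor` BY NAME); elementary lemmas the line restates are the tree's BY NAME (`rotZ_add_vec'` / `rotZ_add_smul_eZ'` = `ScrewBlowdown.…`,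
`rotZ_smul_vec'` = `rotZ_smul`, `rotZ_neg_rotZ'` / `rotZ_rotZ_neg'` = `RotationOrder.…`, `rotZ_zero_vec'` = `rotZ_apply_zero_vec`, `curl_const_smul'` = `curl_const_smul_field`, `continuous_rotZ`,
`centre_mem` = `IsTypeIAncientMild.comp_add_right`, `hasDerivAt_rotZ_rotGen'` = `AxisymEndLiouville.AbsorbingAxisSwirlExtinction.hasDerivAt_rotZ_rotGen`, `rotGen_add_smul_eZ'` =
`PeriodicSlab.rotGen_add_smul_eZ`, `inner_gradient_eq_fderiv` = `Wu2026Salvage.inner_gradient_right_eq`, `rotZ_single_two` = `UnthreadedRigidity.ProfileHorn.rotZ_single_two'` — cone-free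
modules imported); `tendstoLocallyUniformly_comp_of_tendsto`, `analyticAt_linIso`, `smul_coord` (twins of lemmas in route-cone modules) are not re-declared (inlined / replaced by
`PiLp.smul_apply, smul_eq_mul`); `@[conjecture]` on the residual `RingCollapse` (≡ `ScenarioCensus.Row_F1`, OPEN); one-line docstrings added where missing (gate lint).  Statements untouched.

No census VALUE is moved here (row F1 stays OPEN-WITH-LINE; the members become TREE-decided by name); NS regularity is NOT proved; `Row_F1` is untouched (zero
movement, `ringCollapse_iff_rowF1`); no summit statement is proved by this file. Lemmas that restate already-landed tree declarations are taken BY NAME (gate lint `dedup.landed`): `topSet` = `TwoTimeTop.topSet`, `HasTypeIConstant` = `OneLevelTop.HasTypeIConstant`, `snapLevel` = `SnapshotTop.snapLevel`, `exists_fast_at` = `SnapshotTop.exists_fast_at`, `sqrt_mul_sq_mul` = `SnapshotTop.sqrt_mul_sq_mul`, `centre_mem` = `IsTypeIAncientMild.comp_add_right`, `continuous_slice'` = `ScalingTop.continuous_slice'`, `rotZ_add_vec'` = `ScrewBlowdown.rotZ_add_vec`, `rotZ_smul_vec'` = `rotZ_smul`, `rotZ_add_smul_eZ'` = `ScrewBlowdown.rotZ_add_smul_eZ`,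 `rotLin` = `ScrewTop.rotLin`, `rotCLM` = `ScrewTop.rotCLM`, `analyticAt_transport` = `ScrewTop.analyticAt_transport`, `rotZ_smul_eZ'` = `ScrewTop.rotZ_smul_eZ'`, `hasDerivAt_rotZ_rotGen'` = `AxisymEndLiouville.AbsorbingAxisSwirlExtinction.hasDerivAt_rotZ_rotGen`, `rotGen_add_smul_eZ'` = `PeriodicSlab.rotGen_add_smul_eZ`, `inner_gradient_eq_fderiv` = `Wu2026Salvage.inner_gradient_right_eq`, `rotZ_single_two` = `UnthreadedRigidity.ProfileHorn.rotZ_single_two'`, `rotZ_neg_rotZ'` = `RotationOrder.rotZ_neg_rotZ`, `rotZ_rotZ_neg'` = `RotationOrder.rotZ_rotZ_neg`, `rotZ_zero_vec'` = `rotZ_apply_zero_vec`, `curl_const_smul'` = `curl_const_smul_field`, `zoom_units` = `NeedleTop.zoom_units`, `eventually_forall_not_of_not_frequently` = `EchoTop.eventually_forall_not_of_not_frequently`, `le_of_units` = `ScalingTop.le_of_units`, `row_of_floor` = `ScalingTop.row_of_floor`.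
-/

-- the summit and its single problem share the name `NavierStokesRegularity` (D-0017 nested layout)
set_option linter.dupNamespace false

noncomputable section

open MeasureTheory Set Function Filter TopologicalSpace Metric
open scoped Topology NNReal ENNReal InnerProductSpace RealInnerProductSpace

namespace Summit.NavierStokesRegularity.NavierStokesRegularity.Theorems.ScenarioCensus.RingTop

open Literature.Analysis Literature.Analysis.FluidPDE
open Summit.NavierStokesRegularity.NavierStokesRegularity.Theorems
open Summit.NavierStokesRegularity.NavierStokesRegularity.Theses
open Summit.NavierStokesRegularity.NavierStokesRegularity.Theorems.LocalHelicityTubeDoorFrobeniusProfileRigidityHelicalSlice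
open Summit.NavierStokesRegularity.NavierStokesRegularity.Theorems.NearExtremalTransiencePerFlow.FilamentSelection
open Summit.NavierStokesRegularity.NavierStokesRegularity.Theorems.LocalSineTubeDoorProfileAlignedWindowRigidityAncient

/-! ### Structure of the VORTEX-LINE tops in `𝒦_M` and the two kills -/

/-- The curl of an analytic field is analytic. -/
theorem analyticAt_curl {G : E3 → E3} (hG : AnalyticOnNhd ℝ G univ) (y : E3) : AnalyticAt ℝ (curl G) y := by
  rw [curl_eq_curlCLM_comp]
  exact (curlCLM.analyticAt _).comp (hG y (mem_univ y)).fderiv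

/-- The envelope at `s = −1`: the transported slice is bounded by `M`. -/
theorem norm_transport_le {M : ℝ} {W : ℝ → E3 → E3} (hW : IsTypeIAncientMild M W) (L : E3 ≃ₗᵢ[ℝ] E3) (b y : E3) :
    ‖L.symm (W (-1) (L y + b))‖ ≤ M := by
  have h := hW.norm_le (show (-1 : ℝ) < 0 by norm_num) (L y + b)
  rw [neg_neg, Real.sqrt_one, div_one] at h
  simpa only [LinearIsometryEquiv.norm_map] using h

/-- **(KR) A RING TOP KILLS.**  `W ∈ 𝒦_M`; in the frame `L` about the apex `b` the slice `G(w) := L⁻¹W(−1, b + Lw)` has, on the ball of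
radius `a`, its VORTEX LINES TANGENT TO THE COAXIAL CIRCLES (`(curl G)₂ = 0`, `w₀(curl G)₀ + w₁(curl G)₁ = 0`), and AT THE APEX the
velocity is axial (`G(0)₀ = G(0)₁ = 0`).  Then `W ≡ 0`: continuation (slices and their curls are analytic); `curl G = g • J`, `g ∈ C¹`
(Hadamard, tree); `div curl = 0` (tree `divergence_curl_eq_zero_holds`) transports `g` along the circles
(`isAxisymmetricScalar_of_fderiv_rotGen`), so the VORTICITY is axisymmetric; the DRIFT LEMMA (curl covariance + KNSS's harmonic Liouville
`eq_of_curl_eq_zero_of_isDivFree_of_bounded` BY NAME) makes `G − R₋θ∘G∘R_θ` the constant `G(0) − R₋θG(0)`; the apex pin kills it; `G` is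
axisymmetric and the tree's `eq_zero_of_conj_isAxisymmetric_oneSlice` BY NAME ends it. -/
theorem eq_zero_of_ring {M : ℝ} {W : ℝ → E3 → E3} (hW : IsTypeIAncientMild M W) (L : E3 ≃ₗᵢ[ℝ] E3) (b : E3) {a : ℝ} (ha : 0 < a)
    (h2 : ∀ w ∈ ball (0 : E3) a, curl (fun w => L.symm (W (-1) (b + L w))) w 2 = 0)
    (hr : ∀ w ∈ ball (0 : E3) a,
      w 0 * curl (fun w => L.symm (W (-1) (b + L w))) w 0 + w 1 * curl (fun w => L.symm (W (-1) (b + L w))) w 1 = 0)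
    (hp0 : L.symm (W (-1) (b + L 0)) 0 = 0) (hp1 : L.symm (W (-1) (b + L 0)) 1 = 0) :
    ∀ s < 0, ∀ y : E3, W s y = 0 := by
  set G : E3 → E3 := fun y => L.symm (W (-1) (L y + b)) with hGdef
  have hGeq : (fun w => L.symm (W (-1) (b + L w))) = G := funext fun w => by simp only [hGdef, add_comm]
  simp only [hGeq] at h2 hr
  have hG0 : G 0 = L.symm (W (-1) (b + L 0)) := by simp only [hGdef, add_comm]
  have hGa : AnalyticOnNhd ℝ G univ := fun y _ => ScrewTop.analyticAt_transport hW L b y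
  set Ω : E3 → E3 := curl G with hΩdef
  have hΩa : AnalyticOnNhd ℝ Ω univ := fun y _ => analyticAt_curl hGa y
  -- continuation of the three scalar identities
  have hc : ∀ i : Fin 3, AnalyticOnNhd ℝ (fun y : E3 => y i) univ := fun i y _ => (EuclideanSpace.proj i : E3 →L[ℝ] ℝ).analyticAt y
  have hΩi : ∀ i : Fin 3, AnalyticOnNhd ℝ (fun y : E3 => Ω y i) univ := fun i y _ => analyticAt_coord (hΩa y (mem_univ y)) i
  have hra : AnalyticOnNhd ℝ (fun y : E3 => y 0 * Ω y 0 + y 1 * Ω y 1) univ := ((hc 0).mul (hΩi 0)).add ((hc 1).mul (hΩi 1))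
  have hball : ball (0 : E3) a ∈ 𝓝 (0 : E3) := isOpen_ball.mem_nhds (mem_ball_self ha)
  have hev2 : (fun y => Ω y 2) =ᶠ[𝓝 (0 : E3)] 0 := by
    filter_upwards [hball] with w hw
    exact h2 w hw
  have hevr : (fun y : E3 => y 0 * Ω y 0 + y 1 * Ω y 1) =ᶠ[𝓝 (0 : E3)] 0 := by
    filter_upwards [hball] with w hw
    exact hr w hw
  have h2g : ∀ y, Ω y 2 = 0 := fun y =>
    (hΩi 2).eqOn_zero_of_preconnected_of_eventuallyEq_zero isPreconnected_univ (mem_univ 0) hev2 (mem_univ y)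
  have hrg : ∀ y : E3, y 0 * Ω y 0 + y 1 * Ω y 1 = 0 := fun y =>
    hra.eqOn_zero_of_preconnected_of_eventuallyEq_zero isPreconnected_univ (mem_univ 0) hevr (mem_univ y)
  -- structure of the vorticity: `Ω = g • J`, `g ∈ C¹`
  have hG3 : ContDiff ℝ 3 G := hGa.contDiff
  have hΩ2 : ContDiff ℝ 2 Ω := contDiff_curl (n := 2) (by exact_mod_cast hG3)
  obtain ⟨g, hg, hrep⟩ := circular_structure hΩ2 h2g hrg
  have hΩg : Ω = fun y => g y • rotGen y := funext hrep
  have hgd : Differentiable ℝ g := hg.differentiable (by norm_num)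
  -- `div curl = 0` transports `g` along the circles: the VORTICITY is axisymmetric
  have hdivΩ : ∀ x, VectorCalculus.divergence Ω x = 0 := fun x => divergence_curl_eq_zero_holds G hGa.contDiff x
  have h0 : ∀ x : E3, fderiv ℝ g x (rotGen x) = 0 := by
    intro x
    have hx := hdivΩ x
    rw [hΩg, divergence_smul_apply (hgd x) (hasFDerivAt_rotGen x).differentiableAt, divergence_rotGen, mul_zero, zero_add,
      Wu2026Salvage.inner_gradient_right_eq] at hx
    exact hx
  have hax : IsAxisymmetricScalar g := isAxisymmetricScalar_of_fderiv_rotGen hgd h0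
  have hΩax : IsAxisymmetric Ω := by
    have := isAxisymmetric_smul_rotGenL hax
    rw [hΩg]
    simpa [rotGenL_apply] using this
  -- the DRIFT LEMMA and the APEX PIN: the VELOCITY is axisymmetric
  have hV : IsTypeIAncientMild M (fun τ x => L.symm (W τ (L x + b))) := isTypeIAncientMild_conj_affine hW L b
  have hdiv : VectorCalculus.IsDivFree G := hV.isDivFree (by norm_num : (-1 : ℝ) < 0)
  have hM : ∀ y, ‖G y‖ ≤ M := fun y => norm_transport_le hW L b y
  have hG2 : ContDiff ℝ 2 G := hGa.contDiff
  have hdrift : ∀ (θ : ℝ) (y : E3), G y - rotZ (-θ) (G (rotZ θ y)) = G 0 - rotZ (-θ) (G 0) := by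
    intro θ y
    have h := drift hG2 hdiv hM θ 0 (fun y => by rw [add_zero]; exact hΩax θ y) y
    simpa only [add_zero] using h
  have hGax : IsAxisymmetric G :=
    isAxisymmetric_of_drift_apexPin hdrift (by rw [hG0]; exact hp0) (by rw [hG0]; exact hp1)
  exact eq_zero_of_conj_isAxisymmetric_oneSlice hW L b (by norm_num : (-1 : ℝ) < 0) hGax

/-- **(KHR) A HELICAL RING TOP KILLS.**  `W ∈ 𝒦_M`, pitch `h ≠ 0`; on the ball about the apex the slice `G` has its VORTEX LINES TANGENT
TO THE HELICES of pitch `h` (`h(curl G)₀ + w₁(curl G)₂ = 0`, `h(curl G)₁ − w₀(curl G)₂ = 0`) and VANISHES ON THE AXIS POINTS of the ball.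
Then `W ≡ 0`: continuation; `curl G = f • ξ_h`, `f = (curl G)₂/h`; `div curl = 0` makes `f` screw-invariant, so the vorticity is
helically covariant; the DRIFT LEMMA along the screws, the axis pin (small angles) and the screw group property (all angles) give
`G ∘ S_θ = R_θ ∘ G`; the tree's `eq_zero_of_helical_slice_anyAxis` BY NAME ends it. -/
theorem eq_zero_of_helicalRing {M : ℝ} {W : ℝ → E3 → E3} (hW : IsTypeIAncientMild M W) (L : E3 ≃ₗᵢ[ℝ] E3) (b : E3) {h : ℝ}
    (hh : h ≠ 0) {a : ℝ} (ha : 0 < a)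
    (h0 : ∀ w ∈ ball (0 : E3) a,
      h * curl (fun w => L.symm (W (-1) (b + L w))) w 0 + w 1 * curl (fun w => L.symm (W (-1) (b + L w))) w 2 = 0)
    (h1 : ∀ w ∈ ball (0 : E3) a,
      h * curl (fun w => L.symm (W (-1) (b + L w))) w 1 - w 0 * curl (fun w => L.symm (W (-1) (b + L w))) w 2 = 0)
    (hax : ∀ w ∈ ball (0 : E3) a, w 0 = 0 ∧ w 1 = 0 → L.symm (W (-1) (b + L w)) = 0) :
    ∀ s < 0, ∀ y : E3, W s y = 0 := by
  set G : E3 → E3 := fun y => L.symm (W (-1) (L y + b)) with hGdef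
  have hGeq : (fun w => L.symm (W (-1) (b + L w))) = G := funext fun w => by simp only [hGdef, add_comm]
  simp only [hGeq] at h0 h1
  have hGa : AnalyticOnNhd ℝ G univ := fun y _ => ScrewTop.analyticAt_transport hW L b y
  set Ω : E3 → E3 := curl G with hΩdef
  have hΩa : AnalyticOnNhd ℝ Ω univ := fun y _ => analyticAt_curl hGa y
  have hc : ∀ i : Fin 3, AnalyticOnNhd ℝ (fun y : E3 => y i) univ := fun i y _ => (EuclideanSpace.proj i : E3 →L[ℝ] ℝ).analyticAt y
  have hΩi : ∀ i : Fin 3, AnalyticOnNhd ℝ (fun y : E3 => Ω y i) univ := fun i y _ => analyticAt_coord (hΩa y (mem_univ y)) i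
  have h0a : AnalyticOnNhd ℝ (fun y : E3 => h * Ω y 0 + y 1 * Ω y 2) univ :=
    (analyticOnNhd_const.mul (hΩi 0)).add ((hc 1).mul (hΩi 2))
  have h1a : AnalyticOnNhd ℝ (fun y : E3 => h * Ω y 1 - y 0 * Ω y 2) univ :=
    (analyticOnNhd_const.mul (hΩi 1)).sub ((hc 0).mul (hΩi 2))
  have hball : ball (0 : E3) a ∈ 𝓝 (0 : E3) := isOpen_ball.mem_nhds (mem_ball_self ha)
  have hev0 : (fun y : E3 => h * Ω y 0 + y 1 * Ω y 2) =ᶠ[𝓝 (0 : E3)] 0 := by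
    filter_upwards [hball] with w hw
    exact h0 w hw
  have hev1 : (fun y : E3 => h * Ω y 1 - y 0 * Ω y 2) =ᶠ[𝓝 (0 : E3)] 0 := by
    filter_upwards [hball] with w hw
    exact h1 w hw
  have h0g : ∀ y : E3, h * Ω y 0 + y 1 * Ω y 2 = 0 := fun y =>
    h0a.eqOn_zero_of_preconnected_of_eventuallyEq_zero isPreconnected_univ (mem_univ 0) hev0 (mem_univ y)
  have h1g : ∀ y : E3, h * Ω y 1 - y 0 * Ω y 2 = 0 := fun y =>
    h1a.eqOn_zero_of_preconnected_of_eventuallyEq_zero isPreconnected_univ (mem_univ 0) hev1 (mem_univ y)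
  -- structure of the vorticity: `Ω = f • ξ_h`, `f = Ω₂ / h`
  set f : E3 → ℝ := fun y => Ω y 2 / h with hfdef
  have hfa : AnalyticOnNhd ℝ f univ := (hΩi 2).div analyticOnNhd_const fun _ _ => hh
  have hfd : Differentiable ℝ f := fun y => (hfa y (mem_univ y)).differentiableAt
  have hrep : ∀ y, Ω y = f y • (rotGen y + h • eZ) := fun y => corkscrew_structure hh h0g h1g y
  have hΩf : Ω = fun y => f y • (rotGen y + h • eZ) := funext hrep
  -- `div curl = 0` transports `f` along the helices: the VORTICITY is helically covariant
  have hdivΩ : ∀ x, VectorCalculus.divergence Ω x = 0 := fun x => divergence_curl_eq_zero_holds G hGa.contDiff x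
  have hξ : ∀ x : E3, DifferentiableAt ℝ (fun y : E3 => rotGen y + h • eZ) x := fun x =>
    (hasFDerivAt_rotGen x).differentiableAt.add_const _
  have hD : ∀ x : E3, fderiv ℝ f x (rotGen x + h • eZ) = 0 := by
    intro x
    have hx := hdivΩ x
    rw [hΩf, divergence_smul_apply (hfd x) (hξ x), divergence_screwGen, mul_zero, zero_add, Wu2026Salvage.inner_gradient_right_eq] at hx
    exact hx
  have hinv : ∀ (θ : ℝ) (y : E3), f (rotZ θ y + (h * θ) • eZ) = f y := screwInvariant_of_fderiv hfd hD
  have hΩcov : ∀ (θ : ℝ) (y : E3), Ω (rotZ θ y + (h * θ) • eZ) = rotZ θ (Ω y) := by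
    intro θ y
    rw [hrep, hrep y, hinv, PeriodicSlab.rotGen_add_smul_eZ, rotGen_rotZ, rotZ_smul, ScrewBlowdown.rotZ_add_smul_eZ]
  -- the DRIFT LEMMA along the screws and the AXIS PIN: the VELOCITY is helically symmetric
  have hV : IsTypeIAncientMild M (fun τ x => L.symm (W τ (L x + b))) := isTypeIAncientMild_conj_affine hW L b
  have hdiv : VectorCalculus.IsDivFree G := hV.isDivFree (by norm_num : (-1 : ℝ) < 0)
  have hM : ∀ y, ‖G y‖ ≤ M := fun y => norm_transport_le hW L b y
  have hG2 : ContDiff ℝ 2 G := hGa.contDiff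
  have hdrift : ∀ (θ : ℝ) (y : E3),
      G y - rotZ (-θ) (G (rotZ θ y + (h * θ) • eZ)) = G 0 - rotZ (-θ) (G ((h * θ) • eZ)) := fun θ y =>
    drift hG2 hdiv hM θ ((h * θ) • eZ) (hΩcov θ) y
  have hax' : ∀ s : ℝ, |s| < a → G (s • eZ) = 0 := by
    intro s hs
    have hmem : s • eZ ∈ ball (0 : E3) a := by
      rw [mem_ball_zero_iff, norm_smul, Real.norm_eq_abs, show ‖(eZ : E3)‖ = 1 by simp [eZ], mul_one]
      exact hs
    have h := hax (s • eZ) hmem ⟨by simp [eZ], by simp [eZ]⟩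
    simp only [hGdef]
    rw [add_comm]
    exact h
  have hhel' : ∀ (θ : ℝ) (y : E3), G (rotZ θ y + (h * θ) • eZ) = rotZ θ (G y) :=
    screwEquivariant_of_drift_axisPin ha hdrift hax'
  have hhel : ∀ (θ : ℝ) (y : E3), L.symm (W (-1) (L (rotZ θ y + (h * θ) • eZ) + b)) = rotZ θ (L.symm (W (-1) (L y + b))) :=
    fun θ y => by simpa [hGdef] using hhel' θ y
  exact eq_zero_of_helical_slice_anyAxis hW.hasTypeITimeDecay hW.continuousOn_uncurry
    (fun s t hst ht x => hW.mild_eq_heatExtension hst ht x) (fun t ht => hW.isDivFree ht) L b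
    (show (-1 : ℝ) < 0 by norm_num) hh hhel

/-! ### Limits with a MOVING APEX for a first-order defect; the LEVELS (socket of §2 + limit + kill) -/

/-- Evaluating a locally uniformly convergent sequence of slices along a subsequence and a convergent sequence of points (LINE 42
verbatim, any uniform codomain). -/
theorem tendsto_eval {β : Type*} [UniformSpace β] {F : ℕ → E3 → β} {f : E3 → β} (h : TendstoLocallyUniformly F f atTop)
    (hf : Continuous f) {ψ : ℕ → ℕ} (hψ : StrictMono ψ) {p : ℕ → E3} {p₀ : E3} (hp : Tendsto p atTop (𝓝 p₀)) :
    Tendsto (fun j => F (ψ j) (p j)) atTop (𝓝 (f p₀)) :=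
  by
    have h' : TendstoLocallyUniformly (fun j => F (ψ j)) f atTop := fun v hv z => by
      obtain ⟨t, ht, hev⟩ := h v hv z
      exact ⟨t, ht, hψ.tendsto_atTop.eventually hev⟩
    exact h'.tendsto_comp hf.continuousAt hp

/-- A linear isometry as a continuous linear map. -/
def linCLM (L : E3 ≃ₗᵢ[ℝ] E3) : E3 →L[ℝ] E3 := (L.toContinuousLinearEquiv : E3 →L[ℝ] E3)

/-- Component / evaluation formula (`linCLM_apply`). -/
@[simp] theorem linCLM_apply (L : E3 ≃ₗᵢ[ℝ] E3) (y : E3) : linCLM L y = L y := rfl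

/-- The Jacobian-to-curl functional of the frame: `curlFrame L D := curl (L⁻¹ ∘ D ∘ L)`. -/
def curlFrame (L : E3 ≃ₗᵢ[ℝ] E3) (D : E3 →L[ℝ] E3) : E3 := curlCLM ((linCLM L.symm).comp (D.comp (linCLM L)))

/-- `curlFrame L` is continuous (a linear map in finite dimensions). -/
theorem continuous_curlFrame (L : E3 ≃ₗᵢ[ℝ] E3) : Continuous (curlFrame L) := by
  unfold curlFrame
  exact curlCLM.continuous.comp (continuous_const.clm_comp (continuous_id.clm_comp continuous_const))

/-- Differentiability of the transported field `w ↦ L⁻¹ V(b + L w)` at `w` is differentiability of `V` at `b + L w`. -/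
theorem differentiableAt_transport_iff (L : E3 ≃ₗᵢ[ℝ] E3) (V : E3 → E3) (b w : E3) :
    DifferentiableAt ℝ (fun w' => L.symm (V (b + L w'))) w ↔ DifferentiableAt ℝ V (b + L w) := by
  have e1 : (fun w' => L.symm (V (b + L w'))) =
      (L.symm.toContinuousLinearEquiv : E3 ≃L[ℝ] E3) ∘ ((fun z => V (b + z)) ∘ (L.toContinuousLinearEquiv : E3 ≃L[ℝ] E3)) := rfl
  rw [e1, ContinuousLinearEquiv.comp_differentiableAt_iff, ContinuousLinearEquiv.comp_right_differentiableAt_iff]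
  exact differentiableAt_comp_add_left (f := V) b

/-- **The curl of a transported field is the frame functional of the Jacobian** — including the junk case (both sides vanish where the
field is not differentiable). -/
theorem curl_transport (L : E3 ≃ₗᵢ[ℝ] E3) (V : E3 → E3) (b w : E3) :
    curl (fun w' => L.symm (V (b + L w'))) w = curlFrame L (fderiv ℝ V (b + L w)) := by
  unfold curlFrame
  by_cases hV : DifferentiableAt ℝ V (b + L w)
  · have h1 : HasFDerivAt (fun w' : E3 => b + linCLM L w') (linCLM L) w := (linCLM L).hasFDerivAt.const_add b
    have h2 : HasFDerivAt (fun w' : E3 => V (b + linCLM L w')) ((fderiv ℝ V (b + L w)).comp (linCLM L)) w :=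
      hV.hasFDerivAt.comp w h1
    have h3 : HasFDerivAt (fun w' : E3 => L.symm (V (b + L w')))
        ((linCLM L.symm).comp ((fderiv ℝ V (b + L w)).comp (linCLM L))) w :=
      (linCLM L.symm).hasFDerivAt.comp w h2
    rw [curl_eq_curlCLM, h3.fderiv]
  · have hnd : ¬ DifferentiableAt ℝ (fun w' => L.symm (V (b + L w'))) w := fun hd =>
      hV ((differentiableAt_transport_iff L V b w).1 hd)
    rw [curl_eq_curlCLM, fderiv_zero_of_not_differentiableAt hnd, fderiv_zero_of_not_differentiableAt hV]
    simp

-- `curl_const_smul'`: the line restates the tree's `curl_const_smul_field`; taken BY NAME (gate lint dedup.landed).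

/-- The **first-order `D`-defect below `Λ`** of `W` (frame `L`, apex reach `A`, radius `a`): an apex `b`, `‖b‖ ≤ A`, with
`D w (G w) (curl G w) ≤ Λ` for `‖w‖ ≤ a`, `G(w) = L⁻¹ W(−1, b + L w)`. -/
def VDefectBelow (D : E3 → E3 → E3 → ℝ) (L : E3 ≃ₗᵢ[ℝ] E3) (A a Λ : ℝ) (W : ℝ → E3 → E3) : Prop :=
  ∃ b ∈ closedBall (0 : E3) A, ∀ w ∈ closedBall (0 : E3) a,
    D w (L.symm (W (-1) (b + L w))) (curl (fun w' => L.symm (W (-1) (b + L w'))) w) ≤ Λ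

/-- **First-order defect limit** (moving apex): `D`-defects `≤ δ_j` of fields `F_j` whose slices AND slice-gradients converge locally
uniformly to those of `W` (continuous slice, continuous gradient at `s = −1`), `δ_j → δ₀`, give a `D`-defect `≤ δ₀` of `W` — for any `D`
jointly continuous in (value, curl) (compactness of the apex ball, `tendsto_eval` twice, `curl_transport`, continuity of `curlFrame L`). -/
theorem vdefect_limit {D : E3 → E3 → E3 → ℝ} (hDc : ∀ w, Continuous fun p : E3 × E3 => D w p.1 p.2) {L : E3 ≃ₗᵢ[ℝ] E3} {A a : ℝ}
    {F : ℕ → ℝ → E3 → E3} {W : ℝ → E3 → E3} (hWc : Continuous (W (-1))) (hWc1 : Continuous (fderiv ℝ (W (-1))))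
    (hlu : TendstoLocallyUniformly (fun j => F j (-1)) (W (-1)) atTop)
    (hlug : TendstoLocallyUniformly (fun j => fderiv ℝ (F j (-1))) (fderiv ℝ (W (-1))) atTop)
    {δ : ℕ → ℝ} {δ₀ : ℝ} (hδ : Tendsto δ atTop (𝓝 δ₀))
    (hdef : ∀ j, ∃ b ∈ closedBall (0 : E3) A, ∀ w ∈ closedBall (0 : E3) a,
      D w (L.symm (F j (-1) (b + L w))) (curl (fun w' => L.symm (F j (-1) (b + L w'))) w) ≤ δ j) :
    VDefectBelow D L A a δ₀ W := by
  choose b hb hdefb using hdef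
  obtain ⟨b₀, hb₀, ψ, hψ, hlim⟩ := (isCompact_closedBall (0 : E3) A).tendsto_subseq hb
  refine ⟨b₀, hb₀, fun w hw => ?_⟩
  have hpt : Tendsto (fun j => b (ψ j) + L w) atTop (𝓝 (b₀ + L w)) := hlim.add tendsto_const_nhds
  have hval : Tendsto (fun j => L.symm (F (ψ j) (-1) (b (ψ j) + L w))) atTop (𝓝 (L.symm (W (-1) (b₀ + L w)))) :=
    (L.symm.continuous.tendsto _).comp (tendsto_eval hlu hWc hψ hpt)
  have hcurl : Tendsto (fun j => curl (fun w' => L.symm (F (ψ j) (-1) (b (ψ j) + L w'))) w) atTop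
      (𝓝 (curl (fun w' => L.symm (W (-1) (b₀ + L w'))) w)) := by
    simp only [curl_transport]
    exact ((continuous_curlFrame L).tendsto _).comp (tendsto_eval hlug hWc1 hψ hpt)
  have h1 : Tendsto (fun j => D w (L.symm (F (ψ j) (-1) (b (ψ j) + L w))) (curl (fun w' => L.symm (F (ψ j) (-1) (b (ψ j) + L w'))) w))
      atTop (𝓝 (D w (L.symm (W (-1) (b₀ + L w))) (curl (fun w' => L.symm (W (-1) (b₀ + L w'))) w))) :=
    ((hDc w).tendsto _).comp (hval.prodMk_nhds hcurl)
  exact le_of_tendsto_of_tendsto h1 (hδ.comp hψ.tendsto_atTop) (Eventually.of_forall fun j => hdefb (ψ j) w hw)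

/-- Slices of a member of `𝒦_M` have continuous gradients. -/
theorem continuous_fderiv_slice {M : ℝ} {W : ℝ → E3 → E3} (hW : IsTypeIAncientMild M W) {s : ℝ} (hs : s < 0) :
    Continuous (fderiv ℝ (W s)) :=
  ((hW.analyticOnNhd_slice_univ hs).contDiff (n := 1)).continuous_fderiv one_ne_zero

/-- **THE LEVEL of a killing first-order defect**: if `D ≥ 0` is jointly continuous in (value, curl) and EXACT `D`-vanishing of the
transported slice and its curl on a ball about an apex kills every member of `𝒦_M`, then there is ONE level `Λ₁ = Λ₁(M, D, L, A, a, κ) > 0`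
such that no `W ∈ 𝒦_M` with `‖W(−1, 0)‖ ≥ κ` has `D`-defect below `Λ₁` (socket + defect limit + kill; ineffective). -/
theorem exists_level_of_vdefectKill {D : E3 → E3 → E3 → ℝ} (hDc : ∀ w, Continuous fun p : E3 × E3 => D w p.1 p.2)
    (hD0 : ∀ w v ω, 0 ≤ D w v ω) (M : ℝ) (L : E3 ≃ₗᵢ[ℝ] E3) (A a : ℝ) {κ : ℝ} (hκ : 0 < κ)
    (hkill : ∀ (W : ℝ → E3 → E3) (b : E3), IsTypeIAncientMild M W →
      (∀ w ∈ ball (0 : E3) a, D w (L.symm (W (-1) (b + L w))) (curl (fun w' => L.symm (W (-1) (b + L w'))) w) = 0) →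
      ∀ s < 0, ∀ y : E3, W s y = 0) :
    ∃ Λ₁ : ℝ, 0 < Λ₁ ∧ ∀ W : ℝ → E3 → E3, IsTypeIAncientMild M W → κ ≤ ‖W (-1) 0‖ → ¬ VDefectBelow D L A a Λ₁ W := by
  refine exists_level_of_limitKill M hκ (VDefectBelow D L A a) ?_
  intro Wn W ε _ hεlim _ hW hP _ _ hlu hlug
  obtain ⟨b, -, hb⟩ := vdefect_limit hDc (ScalingTop.continuous_slice' hW (by norm_num)) (continuous_fderiv_slice hW (by norm_num))
    (hlu (-1) (by norm_num)) (hlug (-1) (by norm_num)) hεlim hP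
  have h0 : ∀ w ∈ ball (0 : E3) a, D w (L.symm (W (-1) (b + L w))) (curl (fun w' => L.symm (W (-1) (b + L w'))) w) = 0 :=
    fun w hw => le_antisymm (hb w (ball_subset_closedBall hw)) (hD0 _ _ _)
  exact hkill W b hW h0 (-1) (by norm_num) 0

/-- **THE RING LEVEL `Λ₁(M, L, A, a, κ)`** (level lemma + (KR)). -/
theorem exists_ringLevel (M : ℝ) (L : E3 ≃ₗᵢ[ℝ] E3) (A a : ℝ) (ha : 0 < a) {κ : ℝ} (hκ : 0 < κ) :
    ∃ Λ₁ : ℝ, 0 < Λ₁ ∧ ∀ W : ℝ → E3 → E3, IsTypeIAncientMild M W → κ ≤ ‖W (-1) 0‖ →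
      ¬ VDefectBelow ringDefect L A a Λ₁ W :=
  exists_level_of_vdefectKill continuous_ringDefect ringDefect_nonneg M L A a hκ fun _ b hW h0 =>
    have hp := apexPin_zero_eq_zero_iff.1 (ringDefect_eq_zero_iff.1 (h0 0 (mem_ball_self ha))).2
    eq_zero_of_ring hW L b ha (fun w hw => (ringDefect_eq_zero_iff.1 (h0 w hw)).1.1)
      (fun w hw => (ringDefect_eq_zero_iff.1 (h0 w hw)).1.2) hp.1 hp.2

/-- **THE HELICAL RING LEVEL `Λ₁(M, L, h, A, a, κ)`**, `h ≠ 0` (level lemma + (KHR)). -/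
theorem exists_helicalRingLevel (M : ℝ) (L : E3 ≃ₗᵢ[ℝ] E3) {h : ℝ} (hh : h ≠ 0) (A a : ℝ) (ha : 0 < a) {κ : ℝ} (hκ : 0 < κ) :
    ∃ Λ₁ : ℝ, 0 < Λ₁ ∧ ∀ W : ℝ → E3 → E3, IsTypeIAncientMild M W → κ ≤ ‖W (-1) 0‖ →
      ¬ VDefectBelow (helRingDefect h) L A a Λ₁ W :=
  exists_level_of_vdefectKill (continuous_helRingDefect h) (helRingDefect_nonneg h) M L A a hκ fun _ b hW h0 =>
    eq_zero_of_helicalRing hW L b hh ha (fun w hw => (helRingDefect_eq_zero_iff.1 (h0 w hw)).1.1)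
      (fun w hw => (helRingDefect_eq_zero_iff.1 (h0 w hw)).1.2)
      (fun w hw hax => eq_zero_of_axisPin_eq_zero hax (helRingDefect_eq_zero_iff.1 (h0 w hw)).2)

end Summit.NavierStokesRegularity.NavierStokesRegularity.Theorems.ScenarioCensus.RingTop

end
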